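import Mathlib
import Literature.NumberTheory.LFunctions.Zhang2022.Section4Statements
import Literature.NumberTheory.LFunctions.Zhang2022.SkeletonAssembly
import HarnessLib

/-!
# Zhang (2022) §4, first half: DISCHARGES of typed statements of `Section4Statements`, II
# (theorem-only; campaign D-0069 wave 2, row owner L1-t3)

Topic `Literature/NumberTheory/LFunctions/Zhang2022` (Landau–Siegel audit tree; verdict-neutral).
Y. Zhang, *Discrete mean estimates and the Landau–Siegel zero*, arXiv:2211.02515v1 (2022)
[Zhang2022LandauSiegel] — an unrefereed manuscript under adjudication; nothing here asserts or
denies its Theorems 1–2. Companion of `Section4StatementsHolds`; this file PROVES from the tree: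

* `tildeZFormula_holds` — **"By (2.4) with `θ = ψ` and `θ = ψχ` we have
  `Z̃(s,ψ) = χ(−1)τ(ψ)τ(ψχ)(Dp²)^{−s}ϑ(s)²(1 + O(e^{−πt}))`"** (§4 p. 18, DAG `Z22:§4.u022`) with the
  constant `15`, from the tree's exact `GammaFactor.tildeZ_eq` and `norm_corr_le` (`Section4TildeZ`,
  `Section2GammaFactor`), the sign `ψ(−1)·(ψχ)(−1) = χ(−1)` (`psiChi_neg_one`) and
  `p^{−s}(Dp)^{−s} = (Dp²)^{−s}`;
* helpers `psiChi_neg_one` (`(ψχ)(−1) = χ(−1)ψ(−1)`), `one_le_im_of_mem_region45` (`t ≥ 1` on the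
  region of (4.5)–(4.6) once `D ≥ 3`).

No new definitions, no new named facts.

(Revision 2: the first revision also carried `gSumBound180_of` and `midSumPI_holds`; both belong to
the holder of record of `Z22:§4.u028` / `Z22:§4.u035` (files `Section4Lemma44Chain`,
`Section4Eq48Deduction`) and are REMOVED here — `gSumBound180_of` is declared, with the same name and
statement, in `Section4Lemma44Chain`.)

## References

* Y. Zhang, arXiv:2211.02515v1 (2022), §4 p. 18: the display after (4.4).
  [cite: Zhang2022LandauSiegel, §4 p. 18]
-/

noncomputable section

open Complex Real ComplexConjugate MeasureTheory

namespace Literature.NumberTheory.LFunctions.Zhang2022.Section4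

open Skeleton

/-- `𝓛 = log D ≥ 1` for `D ≥ 3`. [cite: Zhang2022LandauSiegel, §2 (2.1)] -/
private theorem one_le_ell_of_three_le'' {D : ℕ} (hD : 3 ≤ D) : 1 ≤ ell D := by
  have hD' : (3 : ℝ) ≤ D := by exact_mod_cast hD
  have h : (1 : ℝ) < Real.log 3 := by
    rw [Real.lt_log_iff_exp_lt (by norm_num)]
    exact Real.exp_one_lt_d9.trans (by norm_num)
  exact le_trans h.le (Real.log_le_log (by norm_num) hD')

/-- `(ψχ)(−1) = χ(−1)ψ(−1)` for the product character `ψχ (mod Dp)`.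
[cite: Zhang2022LandauSiegel, §4 p. 18] -/
theorem psiChi_neg_one {D : ℕ} [NeZero D] (χ : DirichletCharacter ℂ D) (x : Chr D) :
    (psiChi χ x) (-1) = χ (-1) * x.ψ (-1) := by
  have h1 : IsCoprime (-1 : ℤ) ((D * x.p : ℕ) : ℤ) := isCoprime_one_left.neg_left
  have e : ((-1 : ℤ) : ZMod (D * x.p)) = -1 := by push_cast; ring
  have eD : ((-1 : ℤ) : ZMod D) = -1 := by push_cast; ring
  have ep : ((-1 : ℤ) : ZMod x.p) = -1 := by push_cast; ring
  rw [psiChi, MulChar.mul_apply, ← e,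
    DirichletCharacter.changeLevel_eq_cast_of_dvd' χ (dvd_mul_right D x.p) h1,
    DirichletCharacter.changeLevel_eq_cast_of_dvd' x.ψ (dvd_mul_left x.p D) h1, eD, ep]

/-- On the region of (4.5)–(4.6), `t = Im s ≥ 𝓛⁵¹⁹ ≥ 1` (for `D ≥ 3`).
[cite: Zhang2022LandauSiegel, §4 p. 18] -/
theorem one_le_im_of_mem_region45 {D : ℕ} (hD : 3 ≤ D) {s : ℂ} (hs : s ∈ Region45 D) :
    1 ≤ s.im := by
  have hL1 : 1 ≤ ell D := one_le_ell_of_three_le'' hD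
  obtain ⟨-, him⟩ := hs
  have hs0im : (s0 D).im = 2 * π * t0 D := by simp [Skeleton.s0, SmoothWeight.s0]
  rw [Complex.sub_im, hs0im] at him
  have ht0 : t0 D = ell D ^ 519 := rfl
  have hell1 : ell1 D = ell D ^ 405 := rfl
  have h405 : ell D ^ 405 ≤ ell D ^ 519 := pow_le_pow_right₀ hL1 (by norm_num)
  have h519one : (1 : ℝ) ≤ ell D ^ 519 := one_le_pow₀ hL1
  have hπ519 : 3 * ell D ^ 519 ≤ π * ell D ^ 519 :=
    mul_le_mul_of_nonneg_right Real.pi_gt_three.le (by linarith)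
  have h1 := (abs_lt.mp him).1
  rw [hell1, ht0] at h1
  linarith

/-- **"By (2.4) with `θ = ψ` and `θ = ψχ` we have
`Z̃(s,ψ) = χ(−1)τ(ψ)τ(ψχ)(Dp²)^{−s}ϑ(s)²(1 + O(e^{−πt}))`" HOLDS** with the constant `15`
(DAG `Z22:§4.u022`): the tree's exact `GammaFactor.tildeZ_eq` (two (2.4)-corrections `rᵢ`,
`|rᵢ| ≤ 3e^{−πt}`, `GammaFactor.norm_corr_le`), the sign `ψ(−1)·(ψχ)(−1) = χ(−1)` and
`p^{−s}(Dp)^{−s} = (Dp²)^{−s}`; `|(1+r₁)(1+r₂) − 1| ≤ 15e^{−πt}` for `t ≥ 1`.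
[cite: Zhang2022LandauSiegel, §4 p. 18] -/
theorem tildeZFormula_holds : TildeZFormula := by
  refine ⟨15, ForAllLarge.of_le 3 fun D _ χ hD _ _ x s hs => ?_⟩
  have ht1 : 1 ≤ s.im := one_le_im_of_mem_region45 hD hs
  have hspos : 0 < s.im := by linarith
  have hDpos : (0 : ℝ) < D := by exact_mod_cast (show 0 < D by omega)
  have hppos : (0 : ℝ) < x.p := by exact_mod_cast x.prime.pos
  -- the exact formula
  have key := GammaFactor.tildeZ_eq x.ψ (psiChi χ x) hspos
  have hsign : x.ψ (-1) * (psiChi χ x) (-1) = χ (-1) :=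
    GammaFactor.apply_neg_one_mul_eq x.ψ (psiChi_neg_one χ x)
  have hpow : (x.p : ℂ) ^ (-s) * ((D * x.p : ℕ) : ℂ) ^ (-s)
      = (((D : ℝ) * (x.p : ℝ) ^ 2 : ℝ) : ℂ) ^ (-s) := by
    have hDp0 : (0 : ℝ) ≤ (D : ℝ) * x.p := by positivity
    have e1 : ((x.p : ℕ) : ℂ) = ((x.p : ℝ) : ℂ) := (Complex.ofReal_natCast x.p).symm
    have e2 : ((D * x.p : ℕ) : ℂ) = (((D : ℝ) * (x.p : ℝ) : ℝ) : ℂ) := by push_cast; ring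
    have e3 : (((D : ℝ) * (x.p : ℝ) ^ 2 : ℝ) : ℂ)
        = (((D : ℝ) * (x.p : ℝ) : ℝ) : ℂ) * ((x.p : ℝ) : ℂ) := by push_cast; ring
    rw [e1, e2, e3, Complex.mul_cpow_ofReal_nonneg hDp0 hppos.le]
    ring
  set Main : ℂ := χ (-1) * GammaFactor.tau x.ψ * GammaFactor.tau (psiChi χ x) *
      (((D : ℝ) * (x.p : ℝ) ^ 2 : ℝ) : ℂ) ^ (-s) * GammaFactor.vartheta s ^ 2 with hMain
  set r₁ : ℂ := GammaFactor.corr x.ψ s with hr₁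
  set r₂ : ℂ := GammaFactor.corr (psiChi χ x) s with hr₂
  have htz : tildeZW χ x s = Main * ((1 + r₁) * (1 + r₂)) := by
    show GammaFactor.tildeZ x.ψ (psiChi χ x) s = _
    rw [key, hMain, ← hsign, ← hpow]
    ring
  have h1 : ‖r₁‖ ≤ 3 * Real.exp (-π * s.im) := GammaFactor.norm_corr_le x.ψ ht1
  have h2 : ‖r₂‖ ≤ 3 * Real.exp (-π * s.im) := GammaFactor.norm_corr_le (psiChi χ x) ht1
  have he1 : Real.exp (-π * s.im) ≤ 1 := by
    rw [Real.exp_le_one_iff]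
    nlinarith [Real.pi_pos]
  have he0 : 0 ≤ Real.exp (-π * s.im) := (Real.exp_pos _).le
  have hprod : ‖(1 + r₁) * (1 + r₂) - 1‖ ≤ 15 * Real.exp (-π * s.im) := by
    have hexpand : (1 + r₁) * (1 + r₂) - 1 = r₁ + r₂ + r₁ * r₂ := by ring
    rw [hexpand]
    calc ‖r₁ + r₂ + r₁ * r₂‖ ≤ ‖r₁‖ + ‖r₂‖ + ‖r₁‖ * ‖r₂‖ := by
          calc ‖r₁ + r₂ + r₁ * r₂‖ ≤ ‖r₁ + r₂‖ + ‖r₁ * r₂‖ := norm_add_le _ _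
            _ ≤ ‖r₁‖ + ‖r₂‖ + ‖r₁‖ * ‖r₂‖ := by
                gcongr
                · exact norm_add_le _ _
                · exact (norm_mul_le _ _)
      _ ≤ 3 * Real.exp (-π * s.im) + 3 * Real.exp (-π * s.im)
            + 3 * Real.exp (-π * s.im) * (3 * Real.exp (-π * s.im)) := by
          gcongr
      _ ≤ 15 * Real.exp (-π * s.im) := by nlinarith
  rw [htz, show Main * ((1 + r₁) * (1 + r₂)) - Main = Main * ((1 + r₁) * (1 + r₂) - 1) by ring,
    norm_mul]
  calc ‖Main‖ * ‖(1 + r₁) * (1 + r₂) - 1‖ ≤ ‖Main‖ * (15 * Real.exp (-π * s.im)) :=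
        mul_le_mul_of_nonneg_left hprod (norm_nonneg _)
    _ = 15 * Real.exp (-π * s.im) * ‖Main‖ := by ring

end Literature.NumberTheory.LFunctions.Zhang2022.Section4
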